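import Mathlib
import Literature.AlgebraicGeometry.Tropical.InitialIdeal
import Literature.AlgebraicGeometry.Tropical.SchonIdeal
import Literature.AlgebraicGeometry.Tropical.TropicalLink
import Summits.ResolutionOfSingularities.ResolutionOfSingularities.Theorems.TropicalLinksInductiveStepStratumChartsSchon
import Summits.ResolutionOfSingularities.ResolutionOfSingularities.Theorems.TropicalLinksInductiveStepChartTransport
import Summits.ResolutionOfSingularities.ResolutionOfSingularities.Theorems.TropicalLinksInductiveStepRayFibreValuation
import Summits.ResolutionOfSingularities.ResolutionOfSingularities.Theorems.TropicalLinksInductiveStepValuationWeights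

/-!
# TropicalLinks / InductiveStep — the VALUATIVE CRITERION for schön-ness (brick V)

Route `ResolutionOfSingularities/TropicalLinks`, crux `InductiveStep` (stmt-ResolutionOfSingularities-17233),
line `split`, in support of the child `SncClosureSchon` (Luxton–Qu §3).  The algebraic capstone H
(`tropicalLinks_isSchonIdeal_of_stratumCharts`: regular + at every RAY either an empty fibre or a
Luxton–Qu stratum chart WITH positive weights `b` expressing the ray ⇒ schön) is turned into a
statement with no rays, no lattice splittings and no weights — the form in which the geometric
producer (Bertini + forms of large degree on the regular projective closure) delivers it:

* `tropicalLinks_isSchonIdeal_of_valuativeCharts` (registered brick V) — **let `I ⊆ k[ℤⁿ]` be prime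
  with `V(I)` regular.  Suppose that for every valuation `v` of `𝒪 = k[ℤⁿ] ⧸ I` with trivial support
  and `v ≤ 1` on `k` there is a stratum chart `(A, ιA, m, a)` (boundary equations `m`, boundary
  orders `a : ℤⁿ →+ ℤˡ` surjective, `𝒪 = A[1/∏m]`, monomials = units · `m^{a(w)}`, `A` generated by
  the monomials it contains, `m` permutable-regular, `A` Noetherian, `A ⧸ (m)` regular) CENTRED at
  `v` (`A ⊆ V_v`, all `mᵢ ∈ 𝔪_v`).  Then `I` is schön.**

Proof (per lattice splitting `e : ℤⁿ ≃ ℤ × K`, for H): either the ray fibre ring is trivial, or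
(brick E, `tropicalLinks_exists_valuation_of_rayFibre`) there is a valuation of
`𝒪' = k[ℤ × K] ⧸ e·I` non-negative on the image of `k[ℕ × K]` and positive on `x₁` — a valuation
centred on the special fibre of the partial compactification along the ray; pulled back along the
quotient isomorphism of `domCongr e` it is a valuation of `𝒪`, the hypothesis gives a chart centred
at it, the chart is transported to `𝒪'` (brick T, `tropicalLinks_stratumChart_transport`), and the
positive weights with `(e w).1 = Σ bᵢ aᵢ(w)` are READ OFF the valuation (brick W,
`tropicalLinks_exists_weights_of_valuation`: `v(x^w) = γ^{(e w).1}` with `γ = v(x₁) < 1`, and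
`v(mᵢ) = γ^{bᵢ} < 1`).  This is the valuative half of "Trop(Y) ⊆ ⋃_S relint σ_S" (geometric
tropicalization, Hacking–Keel–Tevelev / Luxton–Qu) in the tree's Gröbner dictionary; unimodularity
is relative to the GIVEN lattice `ℤⁿ`, so no intrinsic torus and no unit-group generation is needed.
No new definitions.
-/

-- single-problem summit: the doubled namespace component `ResolutionOfSingularities` is forced
set_option linter.dupNamespace false

namespace Summit.ResolutionOfSingularities.ResolutionOfSingularities.Theorems

open AddMonoidAlgebra Literature.AlgebraicGeometry.Tropical

/-- **The valuative criterion for schön-ness** (registered brick V): a prime `I ⊆ k[ℤⁿ]` with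
`V(I)` regular and a Luxton–Qu stratum chart centred at every valuation of `k[ℤⁿ] ⧸ I` (trivial
support, `≤ 1` on `k`) is schön.  See the module docstring. [folklore] -/
theorem tropicalLinks_isSchonIdeal_of_valuativeCharts :
    ∀ (k : Type) [Field k] (n : ℕ) (I : Ideal (AddMonoidAlgebra k (Fin n → ℤ))), I.IsPrime → (∀ (P : Ideal (AddMonoidAlgebra k (Fin n → ℤ) ⧸ I)) [P.IsPrime], IsRegularLocalRing (Localization.AtPrime P)) → (∀ (Γ₀ : Type) [LinearOrderedCommGroupWithZero Γ₀] (v : Valuation (AddMonoidAlgebra k (Fin n → ℤ) ⧸ I) Γ₀), v.supp = ⊥ → (∀ c : k, v (algebraMap k (AddMonoidAlgebra k (Fin n → ℤ) ⧸ I) c) ≤ 1) → ∃ (A : Type) (_ : CommRing A) (_ : Algebra k A) (ιA : A →ₐ[k] AddMonoidAlgebra k (Fin n → ℤ) ⧸ I) (l : ℕ) (m : Fin l → A) (a : (Fin n → ℤ) →+ (Fin l → ℤ)), Function.Injective ιA ∧ (∀ y : AddMonoidAlgebra k (Fin n → ℤ) ⧸ I, ∃ (x : A) (t : ℕ), y *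 ιA (∏ i, m i) ^ t = ιA x) ∧ Function.Surjective a ∧ (∀ w : Fin n → ℤ, ∃ ε : Aˣ, Ideal.Quotient.mk I (AddMonoidAlgebra.single w (1 : k)) * ιA (∏ i, m i ^ (-(a w i)).toNat) = ιA ((ε : A) * ∏ i, m i ^ (a w i).toNat)) ∧ ιA.range = Algebra.adjoin k {x : AddMonoidAlgebra k (Fin n → ℤ) ⧸ I | ∃ w : Fin n → ℤ, (∀ i, 0 ≤ a w i) ∧ x = Ideal.Quotient.mk I (AddMonoidAlgebra.single w (1 : k))} ∧ (∀ (i : Fin l) (T : Set (Fin l)), i ∉ T → ∀ y : A, m i * y ∈ Ideal.span (m '' T) → y ∈ Ideal.span (m '' T)) ∧ IsNoetherianRing A ∧ (∀ (P : Ideal (A ⧸ Ideal.span (Set.range m))) [P.IsPrime], IsRegularLocalRing (Localization.AtPrime P)) ∧ (∀ x : A, v (ιA x) ≤ 1) ∧ (∀ i, v (ιA (m i)) < 1)) → Literature.AlgebraicGeometry.Tropical.IsSchonIdeal I := by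
  intro k _ n I hI h0 hcharts
  refine tropicalLinks_isSchonIdeal_of_stratumCharts k n I h0 fun K _ e => ?_
  set J : Ideal (AddMonoidAlgebra k (ℤ × K)) := I.map (AddMonoidAlgebra.domCongr k k e) with hJ
  by_cases hsub : Subsingleton (AddMonoidAlgebra k K ⧸ linkIdeal (AddMonoidHom.inr ℕ K)
      (linkIdeal ((Nat.castAddMonoidHom ℤ).prodMap (AddMonoidHom.id K)) J ⊔
        Ideal.span {single ((1 : ℕ), (0 : K)) (1 : k)}))
  · exact Or.inl hsub
  right
  -- the quotient isomorphism `φ : 𝒪 ≃ 𝒪'` induced by the change of coordinates `e`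
  let φ : (AddMonoidAlgebra k (Fin n → ℤ) ⧸ I) ≃ₐ[k] AddMonoidAlgebra k (ℤ × K) ⧸ J :=
    Ideal.quotientEquivAlg I J (AddMonoidAlgebra.domCongr k k e) (by rw [hJ]; rfl)
  have hφ : ∀ u : Fin n → ℤ, φ (Ideal.Quotient.mk I (single u (1 : k))) =
      Ideal.Quotient.mk J (single (e u) (1 : k)) := by
    intro u
    show Ideal.quotientEquivAlg I J (AddMonoidAlgebra.domCongr k k e) _ _ = _
    rw [Ideal.quotientEquivAlg_mk]
    simp [AddMonoidAlgebra.domCongr_single]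
  -- `J` is prime
  haveI hJp : J.IsPrime := by
    rw [hJ]
    exact Ideal.map_isPrime_of_equiv (AddMonoidAlgebra.domCongr k k e)
  -- a valuation on `𝒪'` non-negative on `B` and positive on `x₁`
  obtain ⟨Γ₀, _, v, hsupp, hB, hk, hx⟩ := tropicalLinks_exists_valuation_of_rayFibre k K J hJp hsub
  -- pull it back to `𝒪`
  let v₀ : Valuation (AddMonoidAlgebra k (Fin n → ℤ) ⧸ I) Γ₀ := v.comap (φ : _ →+* _)
  have hsupp₀ : v₀.supp = ⊥ := by
    rw [Valuation.comap_supp, hsupp]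
    exact (RingHom.injective_iff_ker_eq_bot _).1 φ.injective
  have hk₀ : ∀ c : k, v₀ (algebraMap k _ c) ≤ 1 := by
    intro c
    show v (φ (algebraMap k _ c)) ≤ 1
    rw [AlgEquiv.commutes]
    exact hk c
  obtain ⟨A, _, _, ιA, l, m, a, hinj, hloc, hsurj, hmon, hgen, hperm, hN, hreg, hA, hm⟩ :=
    hcharts Γ₀ v₀ hsupp₀ hk₀
  -- transport the chart along `φ`
  obtain ⟨hinj', hloc', hsurj', hmon', hgen'⟩ := tropicalLinks_stratumChart_transport k n I K e J
    φ.toAlgHom φ.bijective hφ A ιA l m a hinj hloc hsurj hmon hgen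
  -- the weights from the valuation
  have hA' : ∀ x : A, v ((φ.toAlgHom.comp ιA) x) ≤ 1 := fun x => hA x
  have hm' : ∀ i, v ((φ.toAlgHom.comp ιA) (m i)) < 1 := fun i => hm i
  have hK : ∀ κ : K, v (Ideal.Quotient.mk J (single ((0 : ℤ), κ) (1 : k))) = 1 := by
    intro κ
    refine le_antisymm (hB ((0 : ℤ), κ) le_rfl) ?_
    have h1 : Ideal.Quotient.mk J (single ((0 : ℤ), κ) (1 : k)) *
        Ideal.Quotient.mk J (single ((0 : ℤ), -κ) (1 : k)) = 1 := by
      rw [← map_mul, AddMonoidAlgebra.single_mul_single, mul_one]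
      have h0 : ((0 : ℤ), κ) + ((0 : ℤ), -κ) = 0 := by simp
      rw [h0, ← AddMonoidAlgebra.one_def, map_one]
    have h2 := hB ((0 : ℤ), -κ) le_rfl
    by_contra hlt
    push Not at hlt
    have := mul_lt_one_of_lt_of_le hlt h2
    rw [← map_mul, h1, map_one] at this
    exact lt_irrefl _ this
  obtain ⟨b, hb, hρ⟩ := tropicalLinks_exists_weights_of_valuation k K J A (φ.toAlgHom.comp ιA) l m
    (a.comp e.symm.toAddMonoidHom) hsurj' hmon' Γ₀ v hA' hm' hK hx
  exact ⟨A, _, _, φ.toAlgHom.comp ιA, l, m, b, a.comp e.symm.toAddMonoidHom, hinj', hloc', hb, hsurj',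
    hρ, hmon', hgen', hperm, hN, hreg⟩

end Summit.ResolutionOfSingularities.ResolutionOfSingularities.Theorems
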